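/-
Copyright (c) 2026 the pub-hodgecm-mathlib formalisation cell (harness21).  Prover seat hodgecm-mathlib-K2E3-p23 (g6), HCML Track B «K2-LIT» ∕ h413
(`stmt-HodgeConjecture-24833`), line `K2_E3_EllipticInputs`, road «GL₂-sc» (road owner K2E5-p17 (g5), dealer K2E3-plan (g4)), NON-ELLIPTIC half, brick 2N-7,
FILE 1 OF 3: the `Fin 2` reading of ★ ASM-2a `K2E3GL3ModUniformizerNonEllCoordinates` (K2E3-p23 (g5)) — THE THREE MEASURABLE COORDINATES OF THE ROAD ON
`G' = GL₂(F) ⧸ ϖ^ℤ`: height `h(x̄)`, NORMALISED DISCRIMINANT `δ(mk g) = ‖disc χ_g‖ ∕ ‖det g‖` (first power of `det` at `N = 2`), depth `L(x̄)`.  2026-09-04.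
-/
import Summits.HodgeConjecture.HodgeConjecture.Theorems.K2E3GL3ModUniformizerNonEllCoordinates   -- ★ ASM-2a (K2E3-p23 g5): GENERIC §1–§2 `exists_measurable_height`, `exists_measurable_depth`
import Summits.HodgeConjecture.HodgeConjecture.Theorems.K2E3GL2ModUniformizerSeparableAE         -- ★ 2N-0d p858891 (this seat): the `G'` frame at `Fin 2`; brings ★ (2F-b) `t2Space_quotScalar`, ★ B0z
import Summits.HodgeConjecture.HodgeConjecture.Theorems.K2E3CharpolyDiscrSmul                     -- ★ generic `discr_charpoly_smul` (`disc χ_{zA} = z^{N(N−1)} disc χ_A`)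
import Literature.NumberTheory.Automorphic.LocalFieldHaarBalls                                     -- ★ `continuous_normAbs`
import HarnessLib

/-!
# Road «GL₂-sc», non-elliptic half, brick 2N-7 (file 1 of 3): the measurable coordinates `h`, `δ`, `L` on `G' = GL₂(F) ⧸ ϖ^ℤ`

Cell `pub/hodgecm-mathlib` (D-0151), Track B «K2-LIT», crux H413 = `stmt-HodgeConjecture-24833`, route of record `HCCMUnconditional`.  Lane
`--supports stmt-HodgeConjecture-24833 --as helper`; THEOREMS ONLY (no `def`, no `instance`, no `notation`, no named-fact hypothesis, no `sorry`); count-neutral.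
`Fin 2` reading of ★ ASM-2a (road «GL-[M6]-sc»).  ★ 2N-5 part 3 (`ae_setIntegral_norm_conj_le_weight`, K2E3-p17 (g8)) bounds the ball integral at a.e. non-elliptic `x̄`
by an expression in three user-supplied coordinates `(h, δ, L)`; this file CONSTRUCTS them (inside proofs, as existential witnesses): §1–§2 (`exists_measurable_height`,
`exists_measurable_depth`) are the GENERIC lemmas of the `N = 3` file, IMPORTED; §3 **`exists_continuous_normDisc`** — `δ(mk g) = ‖disc χ_g‖ ∕ ‖det g‖` is well defined
on `G'` and CONTINUOUS: at `N = 2` the scale-invariant normalisation divides by the FIRST power of `det` (`disc χ_{wg} = w²·disc χ_g` by ★ `discr_charpoly_smul`,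
`det(wg) = w²·det g`; `normAbs_discr_div_det_smul`), matching ★ 2N-1's depth letter `|ϖ^L·d₀d₁| ≤ |(d₀−d₁)²|`; §4 **`exists_coordinates`** — the package
`(h, δ, L)` with all the properties ★ 2N-5 part 3, ★ 2N-6 and the final weight comparison consume.  [HarishChandra1970, Part VII §3 pp. 72–73]
HONEST LABEL: HC_CM is proved only modulo the 7 printed citations (2 remaining named inputs: hLiu418 = stmt-HodgeConjecture-24832, h413 = stmt-HodgeConjecture-24833) until
rung 0 closes; count-neutral helper, closes no socket.

## References
* [HarishChandra1970] Harish-Chandra (notes by G. van Dijk), *Harmonic Analysis on Reductive p-adic Groups*, LNM 162 (1970), Part VII §3 pp. 72–73.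
-/

set_option autoImplicit false
-- the mandated namespace repeats the single-problem summit's segment (`HodgeConjecture.HodgeConjecture`)
set_option linter.dupNamespace false

noncomputable section

open MeasureTheory Measure Set Topology
open scoped MatrixGroups NNReal ENNReal WithZero
open Literature.NumberTheory.Automorphic Literature.NumberTheory.GaloisRepresentations Literature.NumberTheory.GaloisRepresentations.IsNonarchimedeanLocalField
open Summit.HodgeConjecture.HodgeConjecture.Cruxes.H413.K2E3GL3ModUniformizerNonEllCoordinates (exists_measurable_height exists_measurable_depth)
open Summit.HodgeConjecture.HodgeConjecture.Cruxes.H413.K2E3CharpolyDiscrSmul (discr_charpoly_smul)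

namespace Summit.HodgeConjecture.HodgeConjecture.Cruxes.H413.K2E3GL2ModUniformizerNonEllCoordinates

/-! ## §3 The normalised discriminant on `G' = GL₂(F) ⧸ ϖ^ℤ` -/
section NormDisc

variable {F : Type*} [Field F] [ValuativeRel F] [TopologicalSpace F] [IsNonarchimedeanLocalField F]

/-- `‖disc χ_{w g}‖ ∕ ‖det (w g)‖ = ‖disc χ_g‖ ∕ ‖det g‖` for `2 × 2` matrices (`disc` scales by `w²`, `det` by `w²`). [cite: HarishChandra1970, Part VII §3 p. 72 (`D(x)`)] -/
theorem normAbs_discr_div_det_smul {w : F} (hw : w ≠ 0) (M : Matrix (Fin 2) (Fin 2) F) :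
    normAbs F (w • M).charpoly.discr / normAbs F (w • M).det = normAbs F M.charpoly.discr / normAbs F M.det := by
  rw [discr_charpoly_smul, Matrix.det_smul, Fintype.card_fin, map_mul, map_mul]
  exact mul_div_mul_left _ _ ((map_ne_zero _).2 (pow_ne_zero _ hw))

/-- **THE NORMALISED DISCRIMINANT `δ : G' → ℝ≥0`, `δ(mk g) = ‖disc χ_g‖ ∕ ‖det g‖`, is well defined and continuous** (the byte shape of the hypothesis `hδ` of ★ 2N-5 part 3
`ae_setIntegral_norm_conj_le_weight` and ★ 2N-6 `locallyIntegrable_indicator_not_isCompact_centralizer_rpow_neg`). [cite: HarishChandra1970, Part VII §3 p. 72 (`D(x)`)] -/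
theorem exists_continuous_normDisc {ϖ : F} (hϖ0 : ϖ ≠ 0)
    [((Subgroup.zpowers (Units.mk0 ϖ hϖ0)).map (Matrix.GeneralLinearGroup.scalar (Fin 2))).Normal] :
    ∃ δ : GL (Fin 2) F ⧸ (Subgroup.zpowers (Units.mk0 ϖ hϖ0)).map (Matrix.GeneralLinearGroup.scalar (Fin 2)) → ℝ≥0,
      (∀ g : GL (Fin 2) F, δ (QuotientGroup.mk g) =
          normAbs F ((g : Matrix (Fin 2) (Fin 2) F)).charpoly.discr / normAbs F ((g : Matrix (Fin 2) (Fin 2) F)).det) ∧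
      Continuous δ := by
  obtain ⟨f, hf⟩ : ∃ f : GL (Fin 2) F → ℝ≥0, ∀ g, f g =
      normAbs F ((g : Matrix (Fin 2) (Fin 2) F)).charpoly.discr / normAbs F ((g : Matrix (Fin 2) (Fin 2) F)).det := ⟨_, fun _ => rfl⟩
  -- invariance along the fibres of `mk`
  have key : ∀ g n : GL (Fin 2) F, n ∈ (Subgroup.zpowers (Units.mk0 ϖ hϖ0)).map (Matrix.GeneralLinearGroup.scalar (Fin 2)) → f (g * n) = f g := by
    intro g n hn
    obtain ⟨w, -, hw⟩ := Subgroup.mem_map.1 hn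
    have hcoe : (((g * n : GL (Fin 2) F)) : Matrix (Fin 2) (Fin 2) F) = (w : F) • (g : Matrix (Fin 2) (Fin 2) F) := by
      rw [← hw, Units.val_mul, Matrix.GeneralLinearGroup.coe_scalar, Matrix.scalar_apply, ← Matrix.smul_eq_mul_diagonal]
    rw [hf, hf, hcoe]; exact normAbs_discr_div_det_smul w.ne_zero _
  have hmk : ∀ g : GL (Fin 2) F,
      f ((QuotientGroup.mk g : GL (Fin 2) F ⧸ (Subgroup.zpowers (Units.mk0 ϖ hϖ0)).map (Matrix.GeneralLinearGroup.scalar (Fin 2))).out) = f g := fun g => by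
    obtain ⟨h, hh⟩ := QuotientGroup.mk_out_eq_mul ((Subgroup.zpowers (Units.mk0 ϖ hϖ0)).map (Matrix.GeneralLinearGroup.scalar (Fin 2))) g
    rw [hh]; exact key g h h.2
  refine ⟨fun x => f x.out, fun g => (hmk g).trans (hf g), ?_⟩
  -- continuity through the quotient map
  have hfc : Continuous f := by
    have : f = fun g : GL (Fin 2) F =>
        normAbs F ((g : Matrix (Fin 2) (Fin 2) F)).charpoly.discr / normAbs F ((g : Matrix (Fin 2) (Fin 2) F)).det := funext hf
    rw [this]
    refine ((LocalFieldHaar.continuous_normAbs (F := F)).comp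
      ((K2E3NormalizedCharBddNearSemisimpleRegular.continuous_discr_charpoly (R := F) (n := Fin 2)).comp Units.continuous_val)).div
      ((LocalFieldHaar.continuous_normAbs (F := F)).comp ((continuous_id.matrix_det).comp Units.continuous_val)) fun g => ?_
    exact (map_ne_zero _).2 ((Matrix.isUnit_iff_isUnit_det _).1 (Units.isUnit g)).ne_zero
  refine (QuotientGroup.isQuotientMap_mk _).continuous_iff.2 ?_
  convert hfc using 1
  funext g
  exact hmk g

end NormDisc

/-! ## §4 The package on `G'` -/

variable {F : Type*} [Field F] [Valued F ℤᵐ⁰] [ValuativeRel F] [(Valued.v : Valuation F ℤᵐ⁰).Compatible] [IsNonarchimedeanLocalField F]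
  {ϖ : F} (hϖ : Valued.v ϖ = WithZero.exp (-1 : ℤ)) (hϖ0 : ϖ ≠ 0)
  [((Subgroup.zpowers (Units.mk0 ϖ hϖ0)).map (Matrix.GeneralLinearGroup.scalar (Fin 2))).Normal]
  [MeasurableSpace (GL (Fin 2) F ⧸ (Subgroup.zpowers (Units.mk0 ϖ hϖ0)).map (Matrix.GeneralLinearGroup.scalar (Fin 2)))]
  [BorelSpace (GL (Fin 2) F ⧸ (Subgroup.zpowers (Units.mk0 ϖ hϖ0)).map (Matrix.GeneralLinearGroup.scalar (Fin 2)))]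

include hϖ in
/-- **THE COORDINATES `(h, δ, L)` ON `G' = GL₂(F) ⧸ ϖ^ℤ`** for a compact exhaustion `Ω`: measurable height `h` (`x ∈ Ω (h x)`, `h ≤ n` on `Ω n`), continuous normalised discriminant
`δ` (`δ(mk g) = ‖disc χ_g‖ ∕ ‖det g‖`), measurable depth `L` (`q^{-L x} ≤ δ x` for `δ x ≠ 0`, `δ x < q^{-(L x − 1)}` for `L x > 0`, `L = 0` where `δ ≥ 1` or `δ = 0`).
[cite: HarishChandra1970, Part VII §3 pp. 72–73] -/
theorem exists_coordinates (Ω : CompactExhaustion (GL (Fin 2) F ⧸ (Subgroup.zpowers (Units.mk0 ϖ hϖ0)).map (Matrix.GeneralLinearGroup.scalar (Fin 2)))) :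
    ∃ (hgt : GL (Fin 2) F ⧸ (Subgroup.zpowers (Units.mk0 ϖ hϖ0)).map (Matrix.GeneralLinearGroup.scalar (Fin 2)) → ℕ)
      (δ : GL (Fin 2) F ⧸ (Subgroup.zpowers (Units.mk0 ϖ hϖ0)).map (Matrix.GeneralLinearGroup.scalar (Fin 2)) → ℝ≥0)
      (L : GL (Fin 2) F ⧸ (Subgroup.zpowers (Units.mk0 ϖ hϖ0)).map (Matrix.GeneralLinearGroup.scalar (Fin 2)) → ℕ),
      Measurable hgt ∧ (∀ x, x ∈ Ω (hgt x)) ∧ (∀ (n : ℕ) x, x ∈ Ω n → hgt x ≤ n) ∧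
      Continuous δ ∧ (∀ g : GL (Fin 2) F, δ (QuotientGroup.mk g) =
          normAbs F ((g : Matrix (Fin 2) (Fin 2) F)).charpoly.discr / normAbs F ((g : Matrix (Fin 2) (Fin 2) F)).det) ∧
      Measurable L ∧ (∀ x, δ x ≠ 0 → ((residueFieldCard F : ℝ≥0)⁻¹) ^ (L x) ≤ δ x) ∧
        (∀ x, 0 < L x → δ x < ((residueFieldCard F : ℝ≥0)⁻¹) ^ (L x - 1)) ∧ (∀ x, 1 ≤ δ x → L x = 0) ∧ (∀ x, δ x = 0 → L x = 0) := by
  haveI : T2Space (GL (Fin 2) F ⧸ (Subgroup.zpowers (Units.mk0 ϖ hϖ0)).map (Matrix.GeneralLinearGroup.scalar (Fin 2))) :=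
    K2E3GL2ModCocompactCentral.t2Space_quotScalar _ (K2E3GL3ModUniformizerCocompact.isClosed_zpowers_uniformizer hϖ hϖ0)
  obtain ⟨hgt, hm, h1, h2⟩ := exists_measurable_height Ω
  obtain ⟨δ, hδ, hδc⟩ := exists_continuous_normDisc (F := F) hϖ0
  obtain ⟨L, hLm, hL1, hL2, hL3, hL4⟩ := exists_measurable_depth hδc.measurable (inv_residueFieldCard_lt_one (F := F))
  exact ⟨hgt, δ, L, hm, h1, h2, hδc, hδ, hLm, hL1, hL2, hL3, hL4⟩

end Summit.HodgeConjecture.HodgeConjecture.Cruxes.H413.K2E3GL2ModUniformizerNonEllCoordinates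

end
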